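import Summits.Parity.GeneralizedHardyLittlewood.Theses.LeeYangFibres
import Summits.Parity.GeneralizedHardyLittlewood.Theorems.LeeYangFibresCellParityLawSavingDefs
import Summits.Parity.GeneralizedHardyLittlewood.Theorems.LeeYangFibresCellParityLawSavingEngineDefs
import Summits.Parity.GeneralizedHardyLittlewood.Theorems.LeeYangFibresCellParityLawSavingReduction
import Summits.Parity.GeneralizedHardyLittlewood.Theorems.LeeYangFibresCellParityLawSavingHypAlong
import Summits.Parity.GeneralizedHardyLittlewood.Theorems.LeeYangFibresCellParityLawSavingReduceAlong
import Summits.Parity.GeneralizedHardyLittlewood.Theorems.LeeYangFibresCellParityLawSavingMainTermAlong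
import Summits.Parity.GeneralizedHardyLittlewood.Theorems.LeeYangFibresCellParityLawSavingPrepAlong
import Summits.Parity.GeneralizedHardyLittlewood.Theorems.LeeYangFibresCellParityLawSavingAssemblyAlong
import Summits.Parity.GeneralizedHardyLittlewood.Theorems.LeeYangFibresCellParityLawSeqBFacts
import Summits.Parity.GeneralizedHardyLittlewood.Theorems.LeeYangFibresCellParityLawSeqBCells
import Summits.Parity.GeneralizedHardyLittlewood.Theorems.LeeYangFibresCellParityLawDimension
import Summits.Parity.GeneralizedHardyLittlewood.Theorems.LeeYangFibresCellParityLawDimensionLow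
import Summits.Parity.GeneralizedHardyLittlewood.Theorems.LeeYangFibresCellParityLawMertensLowerHead
import Summits.Parity.GeneralizedHardyLittlewood.Theorems.LeeYangFibresCellParityLawSavingVariantDefs
import Summits.Parity.GeneralizedHardyLittlewood.Theorems.LeeYangFibresCellParityLawSavingHypGS
import Summits.Parity.GeneralizedHardyLittlewood.Theorems.LeeYangFibresCellParityLawSavingReduceGS
import HarnessLib

/-!
# Line `superpoly-band-same-atom` (payload slug `SketchIdeator3`) — skeleton v3 for crux
# `LeeYangFibres.CellParityLawSaving` (stmt-Parity-18104) — v3b (Variant B appended)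

Line lead `prover-line-stmt-Parity-18104-0` (opening lead, 2026-08-17). Card
`Cruxes/CellParityLawSaving/Ideas/superpoly-band-same-atom.md` (ideator 3), sketch `Cruxes/…/SketchIdeator3.lean`.

STATE (v3): the line is COMPLETE modulo exactly its two research inputs. Every provable stub has LANDED:
vocabulary p158436 (`…SavingDefs`) and p162376 (`…SavingEngineDefs`); `stub_densityAlong` p159270; `stub_walshStepSav`
p159624; base `stub_baseSavInlined` p161685 (= `LawSavAt 1`, `lawSavAt_one`; Literature by-products p159435, p159626;
helper p160855); reduction `stub_reductionSav` p161939; engine glue `stub_hypAlong` p162981, `stub_reduceAlong` p163375,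
`stub_mainTermAlong` p163446, `stub_prepAlong` p163067, `stub_assemblyAlong` p163257; sorry-free engine `engineSav2_holds`
and the CONDITIONAL closure `scheduleTransfer : (∃ a > 0, SuperPolyRoughCellLaw a) → (∀ t ≥ 1, SectionLevelAlong t) →
CellParityLawSaving` (`…SavingConditional`, p163643). Open registered stubs (the only `sorry`s): `stub_kernel` (KERNEL,
research statement — Ford caps `a ≤ 2`, FI give the polynomial side, truth open) and `stub_atom` (ATOM, the route's
declared conjecture: typed tuple-GEH for the section sequences along the schedule; implies the sister atom).

The crux is the sister crux `LeeYangFibres.CellParityLaw` (stmt-Parity-14109) run ALONG THE SCHEDULE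
`u = U(N) = slowDegree N = max 4 ⌊√(log log N)/2⌋` with a log-power saving `(log N)^{-δ}`: law for `t` forms by induction
(`composeSav2`), base = one progression segment, step = Bombieri's one-parameter section law along the schedule for
`(t+1)`-form systems given the law for `t`-form systems (engine `EngineSav2`, fed by the induction) + tensor/Walsh
assembly. Composition `CellParityLawSaving_of` BY NAME; no `Prop` hypotheses.

VARIANT B (appended, all LANDED; not in the cone of `CellParityLawSaving_of`): the exponent trade-off made explicit —
the POLYNOMIAL-rate kernel uniform in the roughness `PolyRoughCellLawUniform` (rate `u^{Cu} η^κ`) with the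
Granville–Soundararajan-adjacent atom `SectionLevelGSAt c t` (level `N^{1-(log N)^{-1/c}}`, some `c ≥ 2`) also closes the
crux: vocabulary `…SavingVariantDefs` (p163974), glue `stub_hypGS` (p165303), `stub_reduceGS` (p165449), sorry-free engine
`engineGS_holds` and closure `scheduleTransferGS` (`…SavingConditionalGS`, p165657). So, kernel-checked:
`CellParityLawSaving ⟸ (K_a ∧ A_EH) ∨ (K_poly ∧ A_GS)` — `CellParityLawSaving_of_variantB` below.
-/

noncomputable section

open scoped BigOperators Classical
open Finset Filter Literature.NumberTheory.Sieve
open Summit.Parity.GeneralizedHardyLittlewood.Cruxes.CellParityLaw.SectionAnnihilator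
open Summit.Parity.GeneralizedHardyLittlewood.Cruxes.AbsoluteUpgrade.DipMarginRateExchange (slowDegree
  four_le_slowDegree quantClip_schedule)

namespace Summit.Parity.GeneralizedHardyLittlewood.Cruxes.CellParityLawSaving.SuperPolyBand

/-! ## Registered stubs: the line's research inputs (the only open ones) -/

/-- KERNEL (open; research statement, crux-independent sieve theory — Ford caps `a ≤ 2`): the super-polynomial
rough-cell law for some exponent `a > 0`. Nobody's worker material; disprover target. -/
theorem stub_kernel : ∃ a : ℝ, 0 < a ∧ SuperPolyRoughCellLaw a := by
  sorry

/-- ATOM (open; the line's declared conjecture — typed tuple-GEH for the section sequences along the schedule). -/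
theorem stub_atom : ∀ t : ℕ, 1 ≤ t → SectionLevelAlong t := by
  sorry

/-! ## Composition (kernel-checked; everything below the two stubs has landed) -/

/-- The fed engine from the five LANDED glue stubs and the sister's landed `u`-free inputs (= `engineSav2_holds` of
`…SavingConditional`, restated here by the same term so that this skeleton does not depend on that file). -/
theorem engineSav2_all : EngineSav2 :=
  engineSav2_of_pieces stub_sectionSeqBFacts stub_sectionSeqBCells stub_sectionDimension stub_sectionDimensionLow
    stub_sectionMertensLowerHead stub_singularRatio stub_densityAlong stub_hypAlong stub_reduceAlong
    stub_mainTermAlong stub_prepAlong stub_assemblyAlong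

/-- The law along the schedule for every number of forms (induction with the fed engine). -/
theorem lawSavAt_all : ∀ t : ℕ, 1 ≤ t → LawSavAt t :=
  composeSav2 stub_densityAlong stub_singularRatio stub_walshStepSav lawSavAt_one
    (engineSav2_all stub_kernel stub_atom)

/-- The line concludes the crux BY NAME; no `Prop` hypotheses. -/
theorem CellParityLawSaving_of :
    Summit.Parity.GeneralizedHardyLittlewood.Theses.LeeYangFibres.CellParityLawSaving :=
  cellParityLawSaving_of_lawSavAt lawSavAt_all

/-! ## Variant B (landed; recorded for the planners — not in the cone of `CellParityLawSaving_of`) -/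

/-- The Variant-B engine from its two landed glue stubs and the kernel-agnostic landed pieces. -/
theorem engineGS_all : EngineGS :=
  engineGS_of_pieces stub_sectionSeqBFacts stub_sectionSeqBCells stub_sectionDimension stub_sectionDimensionLow
    stub_sectionMertensLowerHead stub_singularRatio stub_densityAlong stub_hypGS stub_reduceGS
    stub_mainTermAlong stub_prepAlong stub_assemblyAlong

/-- **Variant B closes the crux too** (sorry-free implication): polynomial-rate kernel + GS-adjacent atom ⟹ crux. -/
theorem CellParityLawSaving_of_variantB (hKernel : PolyRoughCellLawUniform)
    (hAtom : ∃ c : ℕ, 2 ≤ c ∧ ∀ t : ℕ, 1 ≤ t → SectionLevelGSAt c t) :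
    Summit.Parity.GeneralizedHardyLittlewood.Theses.LeeYangFibres.CellParityLawSaving :=
  cellParityLawSaving_of_lawSavAt
    (composeSav2 stub_densityAlong stub_singularRatio stub_walshStepSav lawSavAt_one (engineGS_all hKernel hAtom))

end Summit.Parity.GeneralizedHardyLittlewood.Cruxes.CellParityLawSaving.SuperPolyBand

end
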